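import Literature.MathematicalPhysics.QuantumFieldTheory.BalabanImbrieJaffe1984to88.BIJ88ScalarTransl582

/-!
# `BalabanImbrieJaffe1984to88.BIJ88ScalarSummary583` — T. Bałaban, J. Imbrie, A. Jaffe, *Effective action and cluster
properties of the abelian Higgs model*, Commun. Math. Phys. **114** (1988) 257–315 [BalabanImbrieJaffe1988], §5.8 *Scalar Field
Translation*, pp. 295–296: the splitting of the cross terms into `𝒬₅ + ⟨φ^{(k)}, w₆ψ⟩`, of the `ψ`-quadratic terms into
`𝒬₆ + ½aL⁻²⟨Λ₈′ψ, (I − aL⁻²QC_{loc}Q*)Λ₈′ψ⟩ + ½⟨ψ, w₇′ψ⟩`, the identity of [7] *"in a localized version … with another small kernel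
w₇″ on the right"* giving `Δ^L_{k+1,loc}`, and the summary **(5.8.3)** — PROVED as inner-product ∕ operator algebra, every
residual kernel with an explicit body

statement-level skeleton of published theorems with citation tags; proofs where landed; nothing here is a claim about the Yang–Mills mass gap

PDF held: `paper:balaban1988-cmp114-bij-abelian-higgs-effective-action` (journal page = PDF page + 256).  Renders read this session as
images: p. 295 = PDF 39, p. 296 = PDF 40 (`pages/original-p039-x2.png`, `-p040-x2.png` in the p02 gen-5 seat folder).

**What the paper prints (pp. 295–296, verbatim).**  *"In the cross terms between φ^{(k)} and ψ, we write ψ = Λ₈^{(k)′}ψ + Λ₈^{(k)′c}ψ.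
The terms with Λ₈^{(k)′c}ψ define 𝒬₅, a form localized near Λ₈^{(k)′c}. The other terms can be written as ⟨φ^{(k)}, w₆ψ⟩, with w₆ a small
kernel with range less than r(e_k). This is because (5.8.1) would eliminate entirely the linear term were it not for the localizations.
In the terms quadratic in ψ, we again combine all terms involving Λ₈^{(k)′c}ψ into a form 𝒬₆ localized near Λ₈^{(k)′c}. The remaining
terms become ½aL⁻²⟨Λ₈^{(k)′}ψ, (I − aL⁻²Q(u_{k+1})C^{(k)}_{loc}(u_{k+1})Q(u_{k+1})*)Λ₈^{(k)′}ψ⟩ + ½⟨ψ, w₇′ψ⟩, with w₇′ another small, local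
kernel. We apply the identity [7] aL⁻²I − a²L⁻⁴Q(u_{k+1})C^{(k)}(u_{k+1})Q(u_{k+1})* = a_kL⁻²I − a_k²L⁻⁴Q_{k+1}(u_{k+1})G^η_{k+1}(u_{k+1})
Q_{k+1}(u_{k+1})*, but in a localized version with C^{(k)}_{loc} and G^η_{k+1,loc} and with another small kernel w₇″ on the right. This
yields the desired form Δ^L_{k+1,loc}(u_{k+1}), and so we obtain ½⟨Λ₈^{(k)′}ψ, Δ^L_{k+1,loc}(u_{k+1})Λ₈^{(k)′}ψ⟩ + ½⟨ψ, w₇ψ⟩, with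
w₇ = w₇′ + w₇″. To summarize, we have written ½⟨Λ₈^{(k−1)′}φ, Δ_{k,loc}(ũ_{k+1})Λ₈^{(k−1)′}φ⟩ + ½aL⁻²⟨ψ − Q(ũ_{k+1})φ, ψ − Q(ũ_{k+1})φ⟩
= 𝒬₄ + 𝒬₅ + 𝒬₆ + ½⟨Λ₈^{(k−1)′}φ^{(k)}, (Δ_{k,loc}(ũ_{k+1}) + aL⁻²P(ũ_{k+1}))Λ₈^{(k−1)′}φ^{(k)}⟩ + ½⟨Λ₈^{(k)″}ψ, Δ^L_{k+1,loc}(u_{k+1})Λ₈^{(k)′}ψ⟩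
+ ⟨φ^{(k)}, w₆ψ⟩ + ½⟨ψ, w₇ψ⟩, (5.8.3) with w₆, w₇ small local kernels, and with 𝒬₄, 𝒬₅, 𝒬₆ localized near Λ₈^{(k)′c}."*
(Print note: the left slot of the `Δ^L` term in (5.8.3) is printed `Λ₈^{(k)″}ψ`; it is `Λ₈^{(k)′}ψ`, as in the display four lines
above it — read so here; recorded in HOME/GAPS.md.)

**What is reproduced here (kernel-checked, zero `sorry`, no named facts).**  Setting of `BIJ88ScalarTransl582` (its `scalarForms`, `Q4`,
`quadPhi`, `crossTerms`, `quadPsi`, `eq582_transl`, `crossTerms_eq_inner` are imported, not restated): real inner-product spaces `M` (unit-lattice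
scalar fields `φ`), `N` (`L`-block fields `ψ`), a real vector space `F` (fine `η`-lattice fields, where `G^η_{k+1}` acts); `a` STANDS FOR THE
PRINTED `aL⁻²`, `ak` for `a_kL⁻²` (bridge to r16's leaf `IdentityB1p296` with `a, a_k, L` separate: `identityB1p296_iff_end`).  The operator
dictionary is the bundle `Ops` (fields documented there), its Euclidean laws `Ops.Laws` (Δ, Λ₈, Λ₈′ symmetric; Λ₈ idempotent, commuting
with P; adjoint pairs (Q, Q*), (T, T*); ⟨Qx, Qy⟩ = ⟨x, Py⟩; the identity of [7] for the UNlocalized C^{(k)}, G^η_{k+1}).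
* §1 `crossOp`, **`Ops.Q5`**, **`Ops.w6`**, **`crossTerms_split`** — cross terms = `⟨φ^{(k)}, Wψ⟩`, `W = Λ₈ΔΛ₈T − aQ*(I − QT)`; `𝒬₅ :=
  ⟨φ^{(k)}, W(ψ − Λ₈′ψ)⟩` (*"the terms with Λ₈′ᶜψ"*), `w₆ := WΛ₈′` (*"the other terms"*); `crossOp_exact`: `W = 0` in [7]'s exact case
  (Λ₈ = I, T = aCQ*, (Δ + aP)C = I) = *"(5.8.1) would eliminate entirely the linear term were it not for the localizations"*.
* §2 `psiForm`, **`Ops.Q6`** (the three bilinear pieces with at least one `Λ₈′ᶜψ`), **`quadPsi_split`**; `w7core`, **`Ops.w7'`**, **`quadPsi_restr`**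
  — the first display of p. 296 with `w₇′ = Λ₈′DΛ₈′`, `D = T*Λ₈ΔΛ₈T − aQT − aT*Q* + aT*PT + a²QC_{loc}Q*` EXPLICIT; `w7core_exact` (`D = 0`
  in the exact case Λ₈ = I, C_{loc} = C, T = aCQ*, T* = aQC, (Δ + aP)C = I).
* §3 **`deltaL`** (`Δ^L_{k+1,loc} := a_kL⁻²I − a_k²L⁻⁴Q_{k+1}G^η_{k+1,loc}Q*_{k+1}`), `locDefect`, **`Ops.w7''`**, **`identity_localized`**: `aL⁻²I −
  a²L⁻⁴QC_{loc}Q* = Δ^L_{k+1,loc} + E`, `E = a²L⁻⁴Q(C − C_{loc})Q* − a_k²L⁻⁴Q_{k+1}(G − G_{loc})Q*_{k+1}` from the exact identity; `locDefect_eq_zero`;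
  the operator-norm shape **`opNorm_locDefect_le`** (‖E‖ ≤ a²‖Q‖‖C − C_{loc}‖‖Q*‖ + a_k²‖Q_{k+1}‖‖G − G_{loc}‖‖Q*_{k+1}‖: w₇″ is small when the
  localizations are good in operator norm, cf. (2.47)).
* §4 **`Ops.eq583`** — **(5.8.3)** assembled from `eq582_transl` + §§1–3 with `w₇ = w₇′ + w₇″` (`Ops.w7`); `eq583_transl581` for r16's `transl581`.

**Readings (declared).**  (i) as in `BIJ88ScalarTransl582` (real Hilbert-space `⟨·,·⟩`, `Λ₈^{(k−1)′}P = PΛ₈^{(k−1)′}`); (ii) `𝒬₅`, `𝒬₆`, `w₆`,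
`w₇′`, `w₇″` are DEFINED by the printed sentences (the terms they are said to collect), so (5.8.3) is an exact identity for every field
configuration; (iii) `Λ₈^{(k)″}` in (5.8.3) read `Λ₈^{(k)′}`.  **NOT claimed:** that `w₆`, `w₇` are small with range `< r(e_k)`, that `𝒬₄`,
`𝒬₅`, `𝒬₆` are localized near `Λ₈^{(k)′c}` (only the explicit defects, their vanishing in [7]'s exact case and the norm shape of `w₇″` are
proved); the identity of [7] is a HYPOTHESIS here (`Ops.Laws.ident`; proved on [7]'s carrier in `BIJ88IdentityB1p296Proof`); nothing of B1–B16;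
NOT summit progress; NOT continuum; NOT Clay.  Imports `BIJ88ScalarTransl582` only; no Summits import; sub-namespace `…BIJ88ScalarSummary583`;
modifies nothing.  Cell `lit-balaban` Phase 2 (HOME `run/shared/lean/pub/lit-balaban/`), seat p02 gen 5 (`literature-prover-lit-balaban-p02-g5-0`);
row **C2.Eq5.8.1-5.8.3** (owner r16, referee ref-5), member (5.8.3) «absent» → proved.
-/

open scoped RealInnerProductSpace
namespace Literature.MathematicalPhysics.QuantumFieldTheory.BalabanImbrieJaffe1984to88.BIJ88ScalarSummary583
open BIJ88ScalarTransl582 BIJ88Sect5StatementsPart4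
noncomputable section

variable {M N F : Type*} [NormedAddCommGroup M] [InnerProductSpace ℝ M] [NormedAddCommGroup N] [InnerProductSpace ℝ N]
  [AddCommGroup F] [Module ℝ F]

/-! ## §1  The cross terms (p. 295): `𝒬₅` and `w₆` -/

/-- The cross-term kernel: after the translation `φ = φ^{(k)} + Tψ` the terms bilinear in `φ^{(k)}`, `ψ` are `⟨φ^{(k)}, Wψ⟩` with
`W = Λ₈ΔΛ₈T − aQ*(I − QT)` (`BIJ88ScalarTransl582.crossTerms_eq_inner`). [cite: BalabanImbrieJaffe1988, (5.8.3) p.296] -/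
def crossOp (a : ℝ) (Λ8 Δ : M →ₗ[ℝ] M) (Q : M →ₗ[ℝ] N) (Qst : N →ₗ[ℝ] M) (T : N →ₗ[ℝ] M) : N →ₗ[ℝ] M :=
  Λ8 ∘ₗ Δ ∘ₗ Λ8 ∘ₗ T - a • (Qst ∘ₗ (LinearMap.id - Q ∘ₗ T))

/-- unfolding `crossOp`. [cite: BalabanImbrieJaffe1988, (5.8.3) p.296] -/
theorem crossOp_apply (a : ℝ) (Λ8 Δ : M →ₗ[ℝ] M) (Q : M →ₗ[ℝ] N) (Qst : N →ₗ[ℝ] M) (T : N →ₗ[ℝ] M) (ψ : N) :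
    crossOp a Λ8 Δ Q Qst T ψ = Λ8 (Δ (Λ8 (T ψ))) - a • Qst (ψ - Q (T ψ)) := by
  simp [crossOp]

/-- *"This is because (5.8.1) would eliminate entirely the linear term were it not for the localizations"* (p. 295): in the exact
case of [7] — no localization `Λ₈ = I`, translation `T = aCQ*` with `(Δ + aP)C = I` and `P = Q*Q` — the cross-term kernel `W`
vanishes identically. [cite: BalabanImbrieJaffe1988, (5.8.3) p.296] -/
theorem crossOp_exact (a : ℝ) {Δ P C : M →ₗ[ℝ] M} {Q : M →ₗ[ℝ] N} {Qst : N →ₗ[ℝ] M}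
    (hPQ : ∀ x : M, P x = Qst (Q x)) (hC : ∀ x : M, Δ (C x) + a • P (C x) = x) (ψ : N) :
    crossOp a LinearMap.id Δ Q Qst (a • (C ∘ₗ Qst)) ψ = 0 := by
  have h1 : Δ (C (Qst ψ)) + a • Qst (Q (C (Qst ψ))) = Qst ψ := by rw [← hPQ]; exact hC (Qst ψ)
  rw [crossOp_apply]
  simp only [LinearMap.id_apply, LinearMap.smul_apply, LinearMap.comp_apply, map_smul, map_sub]
  linear_combination (norm := module) a • h1

section Bundle

variable (M N F) in
/-- The operator dictionary of §5.8 (pp. 295–296): `a` = the printed `aL⁻²`, `ak` = `a_kL⁻²`; on `M` (unit-lattice scalar fields):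
`Λ8` = Λ₈^{(k−1)′}, `Δ` = Δ_{k,loc}(ũ_{k+1}), `P` = P(ũ_{k+1}), `Λ7` = Λ₇^{(k)}, `C` = C^{(k)}(u_{k+1}), `Cloc` = C^{(k)}_{loc}(u_{k+1}); `Q` = Q(ũ_{k+1}) :
M → N` with adjoint `Qst` = Q*; `Tst` = an adjoint of the (5.8.1) shift `T = a·Λ₇C_{loc}Q*`; on `N` (block fields): `Λ8'` = Λ₈^{(k)′};
`Q1` = Q_{k+1}(u_{k+1}) : F → N` with adjoint `Q1st`, `G` = G^η_{k+1}(u_{k+1}), `Gloc` = G^η_{k+1,loc}` on the fine lattice `F`.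
[cite: BalabanImbrieJaffe1988, (5.8.3) p.296] -/
structure Ops where
  (a ak : ℝ)
  (Λ8 Δ P Λ7 C Cloc : M →ₗ[ℝ] M)
  (Q : M →ₗ[ℝ] N) (Qst : N →ₗ[ℝ] M) (Tst : M →ₗ[ℝ] N)
  (Λ8' : N →ₗ[ℝ] N)
  (Q1 : F →ₗ[ℝ] N) (Q1st : N →ₗ[ℝ] F) (G Gloc : F →ₗ[ℝ] F)

namespace Ops

variable (O : Ops M N F)

/-- the (5.8.1) shift `T = aL⁻²·Λ₇^{(k)}C^{(k)}_{loc}Q*`: `φ = φ^{(k)} + Tψ`. [cite: BalabanImbrieJaffe1988, (5.8.1) p.295] -/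
def T : N →ₗ[ℝ] M := O.a • (O.Λ7 ∘ₗ O.Cloc ∘ₗ O.Qst)

/-- r16's typed translation (5.8.1) `transl581 a L Λ7 Cloc Qst φk ψ` is `φ^{(k)} + Tψ` once `aL⁻²` is entered as `O.a`.
[cite: BalabanImbrieJaffe1988, (5.8.1) p.295] -/
theorem transl581_eq_T {a₀ L : ℝ} (ha : O.a = a₀ * L⁻¹ ^ 2) (φk : M) (ψ : N) :
    transl581 a₀ L O.Λ7 O.Cloc O.Qst φk ψ = φk + O.T ψ := by
  simp [transl581, T, ha]

/-- The Euclidean laws of the dictionary: `Δ`, `Λ₈`, `Λ₈′` symmetric, `Λ₈` idempotent and commuting with `P` (reading (i) of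
`BIJ88ScalarTransl582`), `⟨Qx, Qy⟩ = ⟨x, Py⟩` ((4.10) `P = Q*Q`), the adjoint pairs `(Q, Q*)`, `(T, T*)`, and the identity of [7]
p. 296 for the unlocalized `C^{(k)}`, `G^η_{k+1}` (r16's leaf `IdentityB1p296`, see `identityB1p296_iff_end`).
[cite: BalabanImbrieJaffe1988, (5.8.3) p.296] -/
structure Laws : Prop where
  Δsym : ∀ x y : M, ⟪O.Δ x, y⟫ = ⟪x, O.Δ y⟫
  Λ8sym : ∀ x y : M, ⟪O.Λ8 x, y⟫ = ⟪x, O.Λ8 y⟫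
  Λ8idem : ∀ x : M, O.Λ8 (O.Λ8 x) = O.Λ8 x
  Λ8P : ∀ x : M, O.Λ8 (O.P x) = O.P (O.Λ8 x)
  Padj : ∀ x y : M, ⟪O.Q x, O.Q y⟫ = ⟪x, O.P y⟫
  Qadj : ∀ (x : M) (y : N), ⟪O.Q x, y⟫ = ⟪x, O.Qst y⟫
  Tadj : ∀ (y : N) (x : M), ⟪O.T y, x⟫ = ⟪y, O.Tst x⟫
  Λ8'sym : ∀ u v : N, ⟪O.Λ8' u, v⟫ = ⟪u, O.Λ8' v⟫
  ident : O.a • (LinearMap.id : N →ₗ[ℝ] N) - O.a ^ 2 • (O.Q ∘ₗ O.C ∘ₗ O.Qst)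
    = O.ak • LinearMap.id - O.ak ^ 2 • (O.Q1 ∘ₗ O.G ∘ₗ O.Q1st)

/-- **`𝒬₅`** (p. 295): *"In the cross terms between φ^{(k)} and ψ, we write ψ = Λ₈^{(k)′}ψ + Λ₈^{(k)′c}ψ. The terms with Λ₈^{(k)′c}ψ define
𝒬₅, a form localized near Λ₈^{(k)′c}"* := `⟨φ^{(k)}, W(ψ − Λ₈′ψ)⟩`. [cite: BalabanImbrieJaffe1988, (5.8.3) p.296] -/
def Q5 (φk : M) (ψ : N) : ℝ := ⟪φk, crossOp O.a O.Λ8 O.Δ O.Q O.Qst O.T (ψ - O.Λ8' ψ)⟫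

/-- **`w₆`** (p. 295): *"The other terms can be written as ⟨φ^{(k)}, w₆ψ⟩"* := `WΛ₈′`. [cite: BalabanImbrieJaffe1988, (5.8.3) p.296] -/
def w6 : N →ₗ[ℝ] M := crossOp O.a O.Λ8 O.Δ O.Q O.Qst O.T ∘ₗ O.Λ8'

/-- The cross terms split as printed: `crossTerms = 𝒬₅ + ⟨φ^{(k)}, w₆ψ⟩`. [cite: BalabanImbrieJaffe1988, (5.8.3) p.296] -/
theorem crossTerms_split (h : O.Laws) (φk : M) (ψ : N) :
    crossTerms O.a O.Λ8 O.Δ O.Q O.T φk ψ = O.Q5 φk ψ + ⟪φk, O.w6 ψ⟫ := by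
  rw [crossTerms_eq_inner O.a h.Λ8sym h.Qadj, ← crossOp_apply, Q5, w6, LinearMap.comp_apply, ← inner_add_right, ← map_add,
    sub_add_cancel]

end Ops

end Bundle

/-! ## §2  The terms quadratic in `ψ` (p. 296): `𝒬₆`, `w₇′` -/

/-- The bilinear form whose diagonal is `BIJ88ScalarTransl582.quadPsi`: `½⟨Λ₈Tψ₁, ΔΛ₈Tψ₂⟩ + ½a⟨ψ₁ − QTψ₁, ψ₂ − QTψ₂⟩`.
[cite: BalabanImbrieJaffe1988, (5.8.3) p.296] -/
noncomputable def psiForm (a : ℝ) (Λ8 Δ : M →ₗ[ℝ] M) (Q : M →ₗ[ℝ] N) (T : N →ₗ[ℝ] M) (ψ₁ ψ₂ : N) : ℝ :=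
  (1 / 2) * ⟪Λ8 (T ψ₁), Δ (Λ8 (T ψ₂))⟫ + (1 / 2) * a * ⟪ψ₁ - Q (T ψ₁), ψ₂ - Q (T ψ₂)⟫

/-- `quadPsi ψ = psiForm ψ ψ`. [cite: BalabanImbrieJaffe1988, (5.8.3) p.296] -/
theorem quadPsi_eq_psiForm (a : ℝ) (Λ8 Δ : M →ₗ[ℝ] M) (Q : M →ₗ[ℝ] N) (T : N →ₗ[ℝ] M) (ψ : N) :
    quadPsi a Λ8 Δ Q T ψ = psiForm a Λ8 Δ Q T ψ ψ := rfl

/-- additivity of `psiForm` in the first slot. [cite: BalabanImbrieJaffe1988, (5.8.3) p.296] -/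
theorem psiForm_add_left (a : ℝ) (Λ8 Δ : M →ₗ[ℝ] M) (Q : M →ₗ[ℝ] N) (T : N →ₗ[ℝ] M) (ψ₁ ψ₂ ψ₃ : N) :
    psiForm a Λ8 Δ Q T (ψ₁ + ψ₂) ψ₃ = psiForm a Λ8 Δ Q T ψ₁ ψ₃ + psiForm a Λ8 Δ Q T ψ₂ ψ₃ := by
  have hs : ψ₁ + ψ₂ - (Q (T ψ₁) + Q (T ψ₂)) = (ψ₁ - Q (T ψ₁)) + (ψ₂ - Q (T ψ₂)) := by abel
  simp only [psiForm, map_add, hs, inner_add_left]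
  ring

/-- additivity of `psiForm` in the second slot. [cite: BalabanImbrieJaffe1988, (5.8.3) p.296] -/
theorem psiForm_add_right (a : ℝ) (Λ8 Δ : M →ₗ[ℝ] M) (Q : M →ₗ[ℝ] N) (T : N →ₗ[ℝ] M) (ψ₁ ψ₂ ψ₃ : N) :
    psiForm a Λ8 Δ Q T ψ₁ (ψ₂ + ψ₃) = psiForm a Λ8 Δ Q T ψ₁ ψ₂ + psiForm a Λ8 Δ Q T ψ₁ ψ₃ := by
  have hs : ψ₂ + ψ₃ - (Q (T ψ₂) + Q (T ψ₃)) = (ψ₂ - Q (T ψ₂)) + (ψ₃ - Q (T ψ₃)) := by abel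
  simp only [psiForm, map_add, hs, inner_add_right]
  ring

/-- The explicit defect behind `w₇′` (p. 296): `D = T*Λ₈ΔΛ₈T − aQT − aT*Q* + aT*PT + a²QC_{loc}Q*` on `N`, so that
`quadPsi(χ) = ½a⟨χ, (I − aQC_{loc}Q*)χ⟩ + ½⟨χ, Dχ⟩` for every `χ` (`quadPsi_eq_of_adjoint`). [cite: BalabanImbrieJaffe1988, (5.8.3) p.296] -/
def w7core (a : ℝ) (Λ8 Δ P Cloc : M →ₗ[ℝ] M) (Q : M →ₗ[ℝ] N) (Qst : N →ₗ[ℝ] M) (T : N →ₗ[ℝ] M) (Tst : M →ₗ[ℝ] N) :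
    N →ₗ[ℝ] N :=
  Tst ∘ₗ Λ8 ∘ₗ Δ ∘ₗ Λ8 ∘ₗ T - a • (Q ∘ₗ T) - a • (Tst ∘ₗ Qst) + a • (Tst ∘ₗ P ∘ₗ T) + a ^ 2 • (Q ∘ₗ Cloc ∘ₗ Qst)

/-- unfolding `w7core`. [cite: BalabanImbrieJaffe1988, (5.8.3) p.296] -/
theorem w7core_apply (a : ℝ) (Λ8 Δ P Cloc : M →ₗ[ℝ] M) (Q : M →ₗ[ℝ] N) (Qst : N →ₗ[ℝ] M) (T : N →ₗ[ℝ] M)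
    (Tst : M →ₗ[ℝ] N) (χ : N) :
    w7core a Λ8 Δ P Cloc Q Qst T Tst χ =
      Tst (Λ8 (Δ (Λ8 (T χ)))) - a • Q (T χ) - a • Tst (Qst χ) + a • Tst (P (T χ)) + a ^ 2 • Q (Cloc (Qst χ)) := by
  simp [w7core]

/-- For every `χ`: `quadPsi(χ) = ½a⟨χ, χ − aQC_{loc}Q*χ⟩ + ½⟨χ, Dχ⟩`, given `Λ₈` symmetric, the adjoint pairs `(Q, Q*)`, `(T, T*)` and
`⟨Qx, Qy⟩ = ⟨x, Py⟩`. [cite: BalabanImbrieJaffe1988, (5.8.3) p.296] -/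
theorem quadPsi_eq_of_adjoint (a : ℝ) {Λ8 Δ P : M →ₗ[ℝ] M} (Cloc : M →ₗ[ℝ] M) {Q : M →ₗ[ℝ] N} {Qst : N →ₗ[ℝ] M}
    {T : N →ₗ[ℝ] M} {Tst : M →ₗ[ℝ] N}
    (hΛsym : ∀ x y : M, ⟪Λ8 x, y⟫ = ⟪x, Λ8 y⟫) (hP : ∀ x y : M, ⟪Q x, Q y⟫ = ⟪x, P y⟫)
    (hQst : ∀ (x : M) (y : N), ⟪Q x, y⟫ = ⟪x, Qst y⟫) (hTst : ∀ (y : N) (x : M), ⟪T y, x⟫ = ⟪y, Tst x⟫) (χ : N) :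
    quadPsi a Λ8 Δ Q T χ =
      (1 / 2) * a * ⟪χ, χ - a • Q (Cloc (Qst χ))⟫ + (1 / 2) * ⟪χ, w7core a Λ8 Δ P Cloc Q Qst T Tst χ⟫ := by
  have e1 : ⟪Λ8 (T χ), Δ (Λ8 (T χ))⟫ = ⟪χ, Tst (Λ8 (Δ (Λ8 (T χ))))⟫ := by rw [hΛsym, hTst]
  have e2 : ⟪Q (T χ), χ⟫ = ⟪χ, Tst (Qst χ)⟫ := by rw [hQst, hTst]
  have e3 : ⟪Q (T χ), Q (T χ)⟫ = ⟪χ, Tst (P (T χ))⟫ := by rw [hP, hTst]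
  rw [w7core_apply]
  simp only [quadPsi, inner_sub_left, inner_sub_right, inner_add_right, real_inner_smul_right, e1, e2, e3]
  ring

/-- In the exact case of [7] (`Λ₈ = I`, `C_{loc} = C`, `T = aCQ*`, `T* = aQC`, `(Δ + aP)C = I`) the defect `D` vanishes identically —
`w₇′` measures only the localizations. [cite: BalabanImbrieJaffe1988, (5.8.3) p.296] -/
theorem w7core_exact (a : ℝ) {Δ P C : M →ₗ[ℝ] M} {Q : M →ₗ[ℝ] N} {Qst : N →ₗ[ℝ] M}
    (hC : ∀ x : M, Δ (C x) + a • P (C x) = x) (χ : N) :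
    w7core a LinearMap.id Δ P C Q Qst (a • (C ∘ₗ Qst)) (a • (Q ∘ₗ C)) χ = 0 := by
  have h1 : Q (C (Δ (C (Qst χ)))) + a • Q (C (P (C (Qst χ)))) = Q (C (Qst χ)) := by
    have h := congrArg (fun x => Q (C x)) (hC (Qst χ))
    simpa only [map_add, map_smul] using h
  rw [w7core_apply]
  simp only [LinearMap.id_apply, LinearMap.smul_apply, LinearMap.comp_apply, map_smul]
  linear_combination (norm := module) (a * a) • h1

section Bundle

namespace Ops

variable (O : Ops M N F)

/-- **`𝒬₆`** (p. 296): *"In the terms quadratic in ψ, we again combine all terms involving Λ₈^{(k)′c}ψ into a form 𝒬₆ localized near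
Λ₈^{(k)′c}"* := the three bilinear pieces of `quadPsi(Λ₈′ψ + Λ₈′ᶜψ)` containing at least one `Λ₈′ᶜψ = ψ − Λ₈′ψ`.
[cite: BalabanImbrieJaffe1988, (5.8.3) p.296] -/
noncomputable def Q6 (ψ : N) : ℝ :=
  psiForm O.a O.Λ8 O.Δ O.Q O.T (O.Λ8' ψ) (ψ - O.Λ8' ψ) + psiForm O.a O.Λ8 O.Δ O.Q O.T (ψ - O.Λ8' ψ) (O.Λ8' ψ)
    + psiForm O.a O.Λ8 O.Δ O.Q O.T (ψ - O.Λ8' ψ) (ψ - O.Λ8' ψ)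

/-- `quadPsi(ψ) = quadPsi(Λ₈′ψ) + 𝒬₆(ψ)` (bilinearity; no symmetry needed). [cite: BalabanImbrieJaffe1988, (5.8.3) p.296] -/
theorem quadPsi_split (ψ : N) :
    quadPsi O.a O.Λ8 O.Δ O.Q O.T ψ = quadPsi O.a O.Λ8 O.Δ O.Q O.T (O.Λ8' ψ) + O.Q6 ψ := by
  have hψ : O.Λ8' ψ + (ψ - O.Λ8' ψ) = ψ := by abel
  conv_lhs => rw [← hψ]
  rw [quadPsi_eq_psiForm, quadPsi_eq_psiForm, psiForm_add_left, psiForm_add_right, psiForm_add_right, Q6]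
  ring

/-- **`w₇′`** (p. 296): *"½⟨ψ, w₇′ψ⟩, with w₇′ another small, local kernel"* := `Λ₈′DΛ₈′`, `D = w7core` the explicit defect.
[cite: BalabanImbrieJaffe1988, (5.8.3) p.296] -/
def w7' : N →ₗ[ℝ] N := O.Λ8' ∘ₗ w7core O.a O.Λ8 O.Δ O.P O.Cloc O.Q O.Qst O.T O.Tst ∘ₗ O.Λ8'

/-- The first display of p. 296: *"The remaining terms become ½aL⁻²⟨Λ₈^{(k)′}ψ, (I − aL⁻²Q(u_{k+1})C^{(k)}_{loc}(u_{k+1})Q(u_{k+1})*)Λ₈^{(k)′}ψ⟩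
+ ½⟨ψ, w₇′ψ⟩"* — PROVED with the explicit `w₇′`. [cite: BalabanImbrieJaffe1988, (5.8.3) p.296] -/
theorem quadPsi_restr (h : O.Laws) (ψ : N) :
    quadPsi O.a O.Λ8 O.Δ O.Q O.T (O.Λ8' ψ) =
      (1 / 2) * O.a * ⟪O.Λ8' ψ, O.Λ8' ψ - O.a • O.Q (O.Cloc (O.Qst (O.Λ8' ψ)))⟫ + (1 / 2) * ⟪ψ, O.w7' ψ⟫ := by
  rw [quadPsi_eq_of_adjoint O.a O.Cloc h.Λ8sym h.Padj h.Qadj h.Tadj, w7']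
  simp only [LinearMap.comp_apply]
  rw [← h.Λ8'sym]

end Ops

end Bundle

/-! ## §3  The identity of [7] "in a localized version" (p. 296): `Δ^L_{k+1,loc}` and `w₇″`
(the algebra needs no inner product: plain real vector spaces `V` = unit-lattice, `W` = block, `U` = fine-lattice fields) -/

section Generic
variable {V W U : Type*} [AddCommGroup V] [Module ℝ V] [AddCommGroup W] [Module ℝ W] [AddCommGroup U] [Module ℝ U]

/-- **`Δ^L_{k+1,loc}(u_{k+1})`** — *"This yields the desired form Δ^L_{k+1,loc}(u_{k+1})"* (p. 296): the right side of the identity of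
[7] with the localized propagator, `a_kL⁻²I − a_k²L⁻⁴Q_{k+1}G^η_{k+1,loc}Q*_{k+1}` (`ak` = `a_kL⁻²`). [cite: BalabanImbrieJaffe1988, (5.8.3) p.296] -/
def deltaL (ak : ℝ) (Q1 : U →ₗ[ℝ] W) (Gloc : U →ₗ[ℝ] U) (Q1st : W →ₗ[ℝ] U) : W →ₗ[ℝ] W :=
  ak • LinearMap.id - ak ^ 2 • (Q1 ∘ₗ Gloc ∘ₗ Q1st)

/-- The explicit defect behind `w₇″`: `E = a²Q(C − C_{loc})Q* − a_k²Q_{k+1}(G − G_{loc})Q*_{k+1}` (all constants with their `L⁻²`).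
[cite: BalabanImbrieJaffe1988, (5.8.3) p.296] -/
def locDefect (a ak : ℝ) (Q : V →ₗ[ℝ] W) (C Cloc : V →ₗ[ℝ] V) (Qst : W →ₗ[ℝ] V) (Q1 : U →ₗ[ℝ] W) (G Gloc : U →ₗ[ℝ] U)
    (Q1st : W →ₗ[ℝ] U) : W →ₗ[ℝ] W :=
  a ^ 2 • (Q ∘ₗ (C - Cloc) ∘ₗ Qst) - ak ^ 2 • (Q1 ∘ₗ (G - Gloc) ∘ₗ Q1st)

/-- r16's leaf `IdentityB1p296 a a_k L X 1 1 Y 1 1` (the identity of [7] with the two products entered whole in the operator algebra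
`Module.End ℝ W`) IS the operator equation `aL⁻²·I − (aL⁻²)²·X = a_kL⁻²·I − (a_kL⁻²)²·Y`. [cite: BalabanImbrieJaffe1988, (5.8.3) p.296] -/
theorem identityB1p296_iff_end (a₀ ak₀ L : ℝ) (X Y : Module.End ℝ W) :
    IdentityB1p296 a₀ ak₀ L X 1 1 Y 1 1 ↔
      (a₀ * L⁻¹ ^ 2) • (LinearMap.id : W →ₗ[ℝ] W) - (a₀ * L⁻¹ ^ 2) ^ 2 • X
        = (ak₀ * L⁻¹ ^ 2) • LinearMap.id - (ak₀ * L⁻¹ ^ 2) ^ 2 • Y := by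
  have h1 : a₀ ^ 2 * L⁻¹ ^ 4 = (a₀ * L⁻¹ ^ 2) ^ 2 := by ring
  have h2 : ak₀ ^ 2 * L⁻¹ ^ 4 = (ak₀ * L⁻¹ ^ 2) ^ 2 := by ring
  rw [IdentityB1p296, h1, h2]
  simp only [Algebra.algebraMap_eq_smul_one, smul_mul_assoc, one_mul, mul_one]
  exact Iff.rfl

/-- **The identity of [7] in a localized version** (p. 296): from the exact identity `a·I − a²·QC^{(k)}Q* = a_k·I − a_k²·Q_{k+1}G^η_{k+1}Q*_{k+1}`,
`a·I − a²·QC^{(k)}_{loc}Q* = Δ^L_{k+1,loc} + E` with the explicit defect `E = locDefect` (*"with another small kernel w₇″ on the right"*).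
[cite: BalabanImbrieJaffe1988, (5.8.3) p.296] -/
theorem identity_localized {a ak : ℝ} {Q : V →ₗ[ℝ] W} {C : V →ₗ[ℝ] V} (Cloc : V →ₗ[ℝ] V) {Qst : W →ₗ[ℝ] V} {Q1 : U →ₗ[ℝ] W}
    {G : U →ₗ[ℝ] U} (Gloc : U →ₗ[ℝ] U) {Q1st : W →ₗ[ℝ] U}
    (hId : a • (LinearMap.id : W →ₗ[ℝ] W) - a ^ 2 • (Q ∘ₗ C ∘ₗ Qst) = ak • LinearMap.id - ak ^ 2 • (Q1 ∘ₗ G ∘ₗ Q1st)) :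
    a • (LinearMap.id : W →ₗ[ℝ] W) - a ^ 2 • (Q ∘ₗ Cloc ∘ₗ Qst)
      = deltaL ak Q1 Gloc Q1st + locDefect a ak Q C Cloc Qst Q1 G Gloc Q1st := by
  simp only [deltaL, locDefect, LinearMap.comp_sub, LinearMap.sub_comp, smul_sub]
  calc a • (LinearMap.id : W →ₗ[ℝ] W) - a ^ 2 • (Q ∘ₗ Cloc ∘ₗ Qst)
      = (a • LinearMap.id - a ^ 2 • (Q ∘ₗ C ∘ₗ Qst)) + (a ^ 2 • (Q ∘ₗ C ∘ₗ Qst) - a ^ 2 • (Q ∘ₗ Cloc ∘ₗ Qst)) := by abel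
    _ = (ak • LinearMap.id - ak ^ 2 • (Q1 ∘ₗ G ∘ₗ Q1st)) + (a ^ 2 • (Q ∘ₗ C ∘ₗ Qst) - a ^ 2 • (Q ∘ₗ Cloc ∘ₗ Qst)) := by
        rw [hId]
    _ = _ := by abel

/-- With no localization error (`C_{loc} = C`, `G_{loc} = G`) the defect `E` vanishes. [cite: BalabanImbrieJaffe1988, (5.8.3) p.296] -/
theorem locDefect_eq_zero (a ak : ℝ) (Q : V →ₗ[ℝ] W) (C : V →ₗ[ℝ] V) (Qst : W →ₗ[ℝ] V) (Q1 : U →ₗ[ℝ] W) (G : U →ₗ[ℝ] U)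
    (Q1st : W →ₗ[ℝ] U) : locDefect a ak Q C C Qst Q1 G G Q1st = 0 := by
  simp [locDefect]

end Generic

/-- pointwise form of `identity_localized` read against `½a⟨χ, (I − aQC_{loc}Q*)χ⟩`: *"and so we obtain ½⟨Λ₈′ψ, Δ^L_{k+1,loc}Λ₈′ψ⟩ +
½⟨ψ, w₇″…⟩"*. [cite: BalabanImbrieJaffe1988, (5.8.3) p.296] -/
theorem inner_localized {a ak : ℝ} {Q : M →ₗ[ℝ] N} {C : M →ₗ[ℝ] M} (Cloc : M →ₗ[ℝ] M) {Qst : N →ₗ[ℝ] M} {Q1 : F →ₗ[ℝ] N}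
    {G : F →ₗ[ℝ] F} (Gloc : F →ₗ[ℝ] F) {Q1st : N →ₗ[ℝ] F}
    (hId : a • (LinearMap.id : N →ₗ[ℝ] N) - a ^ 2 • (Q ∘ₗ C ∘ₗ Qst) = ak • LinearMap.id - ak ^ 2 • (Q1 ∘ₗ G ∘ₗ Q1st)) (χ : N) :
    (1 / 2) * a * ⟪χ, χ - a • Q (Cloc (Qst χ))⟫ =
      (1 / 2) * ⟪χ, deltaL ak Q1 Gloc Q1st χ⟫ + (1 / 2) * ⟪χ, locDefect a ak Q C Cloc Qst Q1 G Gloc Q1st χ⟫ := by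
  have h := congrArg (fun f : N →ₗ[ℝ] N => ⟪χ, f χ⟫) (identity_localized Cloc Gloc hId)
  simp only [LinearMap.sub_apply, LinearMap.add_apply, LinearMap.smul_apply, LinearMap.id_apply, LinearMap.comp_apply,
    inner_add_right, inner_sub_right, real_inner_smul_right] at h
  rw [inner_sub_right, real_inner_smul_right]
  linear_combination (1 / 2) * h

/-- The operator-norm shape of `w₇″`, for bounded operators between real normed spaces (the same expression as `locDefect`, whose
underlying linear map it is): ‖E‖ ≤ a²‖Q‖‖C − C_{loc}‖‖Q*‖ + a_k²‖Q_{k+1}‖‖G − G_{loc}‖‖Q*_{k+1}‖ — small when the localizations are good in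
operator norm (cf. (2.47)); the paper's range statement is not claimed. [cite: BalabanImbrieJaffe1988, (5.8.3) p.296] -/
theorem opNorm_locDefect_le {M' N' F' : Type*} [NormedAddCommGroup M'] [NormedSpace ℝ M'] [NormedAddCommGroup N']
    [NormedSpace ℝ N'] [NormedAddCommGroup F'] [NormedSpace ℝ F'] (a ak : ℝ) (Q : M' →L[ℝ] N') (C Cloc : M' →L[ℝ] M')
    (Qst : N' →L[ℝ] M') (Q1 : F' →L[ℝ] N') (G Gloc : F' →L[ℝ] F') (Q1st : N' →L[ℝ] F') :
    ‖a ^ 2 • (Q ∘L (C - Cloc) ∘L Qst) - ak ^ 2 • (Q1 ∘L (G - Gloc) ∘L Q1st)‖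
      ≤ a ^ 2 * (‖Q‖ * (‖C - Cloc‖ * ‖Qst‖)) + ak ^ 2 * (‖Q1‖ * (‖G - Gloc‖ * ‖Q1st‖)) := by
  refine (norm_sub_le _ _).trans (add_le_add ?_ ?_)
  · rw [norm_smul, Real.norm_eq_abs, abs_sq]
    refine mul_le_mul_of_nonneg_left ?_ (sq_nonneg a)
    exact (ContinuousLinearMap.opNorm_comp_le _ _).trans
      (mul_le_mul_of_nonneg_left (ContinuousLinearMap.opNorm_comp_le _ _) (norm_nonneg _))
  · rw [norm_smul, Real.norm_eq_abs, abs_sq]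
    refine mul_le_mul_of_nonneg_left ?_ (sq_nonneg ak)
    exact (ContinuousLinearMap.opNorm_comp_le _ _).trans
      (mul_le_mul_of_nonneg_left (ContinuousLinearMap.opNorm_comp_le _ _) (norm_nonneg _))

section Bundle

namespace Ops

variable (O : Ops M N F)

/-- the bundle's `Δ^L_{k+1,loc}(u_{k+1}) = a_kL⁻²I − a_k²L⁻⁴Q_{k+1}G^η_{k+1,loc}Q*_{k+1}`. [cite: BalabanImbrieJaffe1988, (5.8.3) p.296] -/
def deltaLloc : N →ₗ[ℝ] N := deltaL O.ak O.Q1 O.Gloc O.Q1st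

/-- **`w₇″`** (p. 296): *"with another small kernel w₇″ on the right"* := `Λ₈′EΛ₈′`, `E = locDefect` the explicit localization defect of
the identity of [7]. [cite: BalabanImbrieJaffe1988, (5.8.3) p.296] -/
def w7'' : N →ₗ[ℝ] N := O.Λ8' ∘ₗ locDefect O.a O.ak O.Q O.C O.Cloc O.Qst O.Q1 O.G O.Gloc O.Q1st ∘ₗ O.Λ8'

/-- **`w₇ = w₇′ + w₇″`** (p. 296). [cite: BalabanImbrieJaffe1988, (5.8.3) p.296] -/
def w7 : N →ₗ[ℝ] N := O.w7' + O.w7''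

/-- p. 296: *"This yields the desired form Δ^L_{k+1,loc}(u_{k+1}), and so we obtain ½⟨Λ₈^{(k)′}ψ, Δ^L_{k+1,loc}(u_{k+1})Λ₈^{(k)′}ψ⟩ + ½⟨ψ, w₇ψ⟩,
with w₇ = w₇′ + w₇″"* — the `ψ`-quadratic terms restricted to `Λ₈′ψ`, PROVED. [cite: BalabanImbrieJaffe1988, (5.8.3) p.296] -/
theorem quadPsi_restr_eq_deltaL (h : O.Laws) (ψ : N) :
    quadPsi O.a O.Λ8 O.Δ O.Q O.T (O.Λ8' ψ) = (1 / 2) * ⟪O.Λ8' ψ, O.deltaLloc (O.Λ8' ψ)⟫ + (1 / 2) * ⟪ψ, O.w7 ψ⟫ := by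
  rw [O.quadPsi_restr h ψ, inner_localized O.Cloc O.Gloc h.ident (O.Λ8' ψ), w7, deltaLloc, LinearMap.add_apply,
    inner_add_right, w7'']
  simp only [LinearMap.comp_apply]
  rw [← h.Λ8'sym ψ]
  ring

/-! ## §4  The summary (5.8.3) -/

/-- **(5.8.3)** p. 296 [PDF 40], verbatim: *"To summarize, we have written ½⟨Λ₈^{(k−1)′}φ, Δ_{k,loc}(ũ_{k+1})Λ₈^{(k−1)′}φ⟩ +
½aL⁻²⟨ψ − Q(ũ_{k+1})φ, ψ − Q(ũ_{k+1})φ⟩ = 𝒬₄ + 𝒬₅ + 𝒬₆ + ½⟨Λ₈^{(k−1)′}φ^{(k)}, (Δ_{k,loc}(ũ_{k+1}) + aL⁻²P(ũ_{k+1}))Λ₈^{(k−1)′}φ^{(k)}⟩ +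
½⟨Λ₈^{(k)′}ψ, Δ^L_{k+1,loc}(u_{k+1})Λ₈^{(k)′}ψ⟩ + ⟨φ^{(k)}, w₆ψ⟩ + ½⟨ψ, w₇ψ⟩, (5.8.3)"* — PROVED for `φ = φ^{(k)} + Tψ` (5.8.1) under the
Euclidean laws `Ops.Laws`, with `𝒬₄` of `BIJ88ScalarTransl582` and the explicit `𝒬₅`, `𝒬₆`, `w₆`, `w₇` of this file (reading (iii):
the printed `Λ₈^{(k)″}` is `Λ₈^{(k)′}`). [cite: BalabanImbrieJaffe1988, (5.8.3) p.296] -/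
theorem eq583 (h : O.Laws) (φk : M) (ψ : N) :
    scalarForms O.a O.Λ8 O.Δ O.Q (φk + O.T ψ) ψ =
      Q4 O.a O.Λ8 O.P φk + O.Q5 φk ψ + O.Q6 ψ
        + (1 / 2) * ⟪O.Λ8 φk, O.Δ (O.Λ8 φk) + O.a • O.P (O.Λ8 φk)⟫
        + (1 / 2) * ⟪O.Λ8' ψ, O.deltaLloc (O.Λ8' ψ)⟫
        + ⟪φk, O.w6 ψ⟫ + (1 / 2) * ⟪ψ, O.w7 ψ⟫ := by
  rw [eq582_transl O.a h.Δsym h.Padj h.Λ8sym h.Λ8idem h.Λ8P O.T φk ψ, O.crossTerms_split h, O.quadPsi_split,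
    O.quadPsi_restr_eq_deltaL h, quadPhi]
  ring

/-- (5.8.3) for r16's typed translation `transl581` (5.8.1) with `aL⁻²` entered as `O.a`. [cite: BalabanImbrieJaffe1988, (5.8.3) p.296] -/
theorem eq583_transl581 (h : O.Laws) {a₀ L : ℝ} (ha : O.a = a₀ * L⁻¹ ^ 2) (φk : M) (ψ : N) :
    scalarForms O.a O.Λ8 O.Δ O.Q (transl581 a₀ L O.Λ7 O.Cloc O.Qst φk ψ) ψ =
      Q4 O.a O.Λ8 O.P φk + O.Q5 φk ψ + O.Q6 ψ
        + (1 / 2) * ⟪O.Λ8 φk, O.Δ (O.Λ8 φk) + O.a • O.P (O.Λ8 φk)⟫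
        + (1 / 2) * ⟪O.Λ8' ψ, O.deltaLloc (O.Λ8' ψ)⟫
        + ⟪φk, O.w6 ψ⟫ + (1 / 2) * ⟪ψ, O.w7 ψ⟫ := by
  rw [O.transl581_eq_T ha, O.eq583 h]

/-- The localization forms vanish when there is no localization on the `ψ` side (`Λ₈′ = I`): `𝒬₅ = 0`, `𝒬₆ = 0`.
[cite: BalabanImbrieJaffe1988, (5.8.3) p.296] -/
theorem Q5_Q6_eq_zero_of_id (hΛ : O.Λ8' = LinearMap.id) (φk : M) (ψ : N) : O.Q5 φk ψ = 0 ∧ O.Q6 ψ = 0 := by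
  constructor
  · simp [Q5, hΛ]
  · simp [Q6, hΛ, psiForm]

end Ops

end Bundle

end

end Literature.MathematicalPhysics.QuantumFieldTheory.BalabanImbrieJaffe1984to88.BIJ88ScalarSummary583
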